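import Mathlib
import Summits.NavierStokesRegularity.NavierStokesRegularity.Theorems.FilamentSkeletonRssStadiumRightWingGeneral

/-!
# Route `FilamentSkeletonRss` · cruxes `SkeletonJ1L` (stmt-NavierStokesRegularity-23296, registered stub `stub_tangentSkeletonL` ≡
# `TangentSkeletonNearStraightL`, stmt-23320) · line `child_tangent_analytic_strip_L` (b0b56c52900dd90a), stub `stub_stripPropagation` —
# brick for `rcore`: POSITIVITY ALONG THE LEFT WING OF EVERY ANCHOR'S TENT, IN SEGMENT FORM (point reflection of the right wing)

The quarter-width tent of an anchor `z₀ = x₀ + iY₀` (`|Y₀| < hs/4`, `|x₀ − cc| < L + hs/4`) is SYMMETRIC: left foot `σ ≤ x₀ − hs/2`, left ascent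
`[x₀ − hs/2, (x₀ − hs/5) + iY₀]`, left plateau `[(x₀ − hs/5) + iY₀, z₀]`, then the right wing of `Theorems.StadiumRightWingGeneral` and the right foot
(`Theorems.StadiumQuarterFeetFrozen` already places BOTH feet at `Re z ± hs/2`).  The left wing of `z₀` is the right wing of the anchor `x₀ − iY₀` of the
POINT-REFLECTED data `F ∘ (2x₀ − ·)`, `X ∘ (2x₀ − ·)`, centre `2x₀ − cc` (`Theorems.StadiumCornerTransport.reflect_package`: same stadium hypotheses),
and the positivity quantity `Re(Σᵢ (Fᵢ z₀ − Fᵢ ζ)² + κ G ζ)` is transported literally.  So: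
* `left_wing_pos_general` — pointwise positivity along both left segments, stated in TENT ORIENTATION (foot → target), for every anchor of the
  quarter stadium and either sign of `Y₀` (from `right_wing_pos_general`);
* `left_wing_in_stadium` — both segments lie in the stadium.
With `right_wing_pos_general` these are the four `hpos` / `hseg` inputs of `Theorems.StadiumTentFreezeNhds.tent_eq_frozen_nhds_sharp` for the
symmetric tent.
HONEST FRAMING: bookkeeping for a HYPOTHETICAL filament skeleton on the NEGATIVE side of a MODEL route; the stub `stub_stripPropagation` is NOT closed
by this file, `TangentSkeletonNearStraightL` / `SkeletonJ1L` stay OPEN; nothing here bears on Navier–Stokes regularity or blow-up.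
`--supports stmt-NavierStokesRegularity-23320` (≡ stub `stub_tangentSkeletonL` of 23296).
-/

set_option linter.dupNamespace false

noncomputable section

namespace Summit.NavierStokesRegularity.NavierStokesRegularity.Theorems.StadiumLeftWingPos

open Set Complex
open scoped InnerProductSpace
open Summit.NavierStokesRegularity.NavierStokesRegularity.Theorems.StadiumRightWingGeneral
open Summit.NavierStokesRegularity.NavierStokesRegularity.Theorems.StadiumCornerTransport
open Summit.NavierStokesRegularity.NavierStokesRegularity.Theorems.StadiumDeviationReflect

/-- **Left-wing positivity for every anchor of the quarter stadium, tent orientation.**  Stadium `S = {|Im| < hs, |Re − cc| < L + hs}`, `F` holomorphic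
on `S` with `‖F′‖ ≤ 2`, `Σ (F′)ᵢ² = 1`, real trace `X` (`C¹`, unit speed, tangent oscillation `≤ Rb ≤ 1/2`), a core continuation with `Re G ≥ g₀ > 0` on
`S`, `κ > 0`; anchor `z₀ = x₀ + iY₀` with `|Y₀| < hs/4`, `|x₀ − cc| < L + hs/4`.  Then for `t ∈ [0,1]`, along the ascent
`p = x₀ − hs/2 → q = (x₀ − hs/5) + iY₀` and along the plateau `q → z₀`: `0 < Re(Σᵢ (Fᵢ z₀ − Fᵢ(p + t(q − p)))² + κ G(p + t(q − p)))`. [folklore] -/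
theorem left_wing_pos_general {hs L cc : ℝ} {F : ℂ → (Fin 3 → ℂ)}
    (hF : DifferentiableOn ℂ F {z : ℂ | |z.im| < hs ∧ |z.re - cc| < L + hs})
    (hM : ∀ z ∈ {z : ℂ | |z.im| < hs ∧ |z.re - cc| < L + hs}, ‖deriv F z‖ ≤ 2)
    (hunit : ∀ w ∈ {z : ℂ | |z.im| < hs ∧ |z.re - cc| < L + hs}, ∑ i, (deriv F w i) ^ 2 = 1)
    {X : ℝ → EuclideanSpace ℝ (Fin 3)} (hX : ContDiff ℝ 1 X) (hXu : ∀ τ, ‖deriv X τ‖ = 1)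
    {Rb : ℝ} (hRb0 : 0 ≤ Rb) (hRb : Rb ≤ 1 / 2) (hosc : ∀ τ σ, ‖deriv X τ - deriv X σ‖ ≤ Rb)
    (hFX : ∀ r : ℝ, (r : ℂ) ∈ {z : ℂ | |z.im| < hs ∧ |z.re - cc| < L + hs} →
      F r = fun i => ((⟪X r, EuclideanSpace.single i (1:ℝ)⟫_ℝ : ℝ) : ℂ))
    (hhs : 0 < hs) {x₀ Y₀ : ℝ} (hY : |Y₀| < hs / 4) (hx₀ : |x₀ - cc| < L + hs / 4)
    {G : ℂ → ℂ} {κ g₀ : ℝ} (hκ : 0 < κ) (hg₀ : 0 < g₀)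
    (hG : ∀ w ∈ {z : ℂ | |z.im| < hs ∧ |z.re - cc| < L + hs}, g₀ ≤ (G w).re) :
    (∀ t ∈ Icc (0:ℝ) 1,
      0 < ((∑ i, (F ((x₀ : ℂ) + (Y₀ : ℂ) * Complex.I) i -
          F (((x₀ - hs / 2 : ℝ) : ℂ) + (t : ℂ) *
            ((((x₀ - hs / 5 : ℝ) : ℂ) + (Y₀ : ℂ) * Complex.I) - ((x₀ - hs / 2 : ℝ) : ℂ))) i) ^ 2) +
        (κ : ℂ) * G (((x₀ - hs / 2 : ℝ) : ℂ) + (t : ℂ) *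
            ((((x₀ - hs / 5 : ℝ) : ℂ) + (Y₀ : ℂ) * Complex.I) - ((x₀ - hs / 2 : ℝ) : ℂ)))).re) ∧
    (∀ t ∈ Icc (0:ℝ) 1,
      0 < ((∑ i, (F ((x₀ : ℂ) + (Y₀ : ℂ) * Complex.I) i -
          F ((((x₀ - hs / 5 : ℝ) : ℂ) + (Y₀ : ℂ) * Complex.I) + (t : ℂ) *
            (((x₀ : ℂ) + (Y₀ : ℂ) * Complex.I) - (((x₀ - hs / 5 : ℝ) : ℂ) + (Y₀ : ℂ) * Complex.I))) i) ^ 2) +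
        (κ : ℂ) * G ((((x₀ - hs / 5 : ℝ) : ℂ) + (Y₀ : ℂ) * Complex.I) + (t : ℂ) *
            (((x₀ : ℂ) + (Y₀ : ℂ) * Complex.I) - (((x₀ - hs / 5 : ℝ) : ℂ) + (Y₀ : ℂ) * Complex.I)))).re) := by
  set S : Set ℂ := {z : ℂ | |z.im| < hs ∧ |z.re - cc| < L + hs} with hS
  set S' : Set ℂ := {z : ℂ | |z.im| < hs ∧ |z.re - (2 * x₀ - cc)| < L + hs} with hS'
  -- the reflected data satisfy the same stadium hypotheses
  obtain ⟨hF', hM', hunit', hX', hXu', hosc', hFX'⟩ := reflect_package (x := x₀) hF hM hunit hX hXu hosc hFX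
  have hx₀' : |x₀ - (2 * x₀ - cc)| < L + hs / 4 := by
    rw [show x₀ - (2 * x₀ - cc) = -(x₀ - cc) by ring, abs_neg]; exact hx₀
  have hY' : |(-Y₀)| < hs / 4 := by rw [abs_neg]; exact hY
  have hG' : ∀ w ∈ S', g₀ ≤ ((fun w => G (2 * (x₀ : ℂ) - w)) w).re := fun w hw =>
    hG _ ((reflect_mem_iff (hs := hs) (L := L) (cc := cc) (x := x₀) w).2 hw)
  obtain ⟨hp, hd⟩ := right_wing_pos_general hF' hM' hunit' hX' hXu' hRb0 hRb hosc' hFX' hhs hY' hx₀' (G := fun w => G (2 * (x₀ : ℂ) - w))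
    hκ hg₀ hG'
  -- the reflected anchor and the reflected right-wing points are the anchor and the left-wing points (parameter `1 − t`)
  have e0 : 2 * (x₀ : ℂ) - ((x₀ : ℂ) + ((-Y₀ : ℝ) : ℂ) * Complex.I) = (x₀ : ℂ) + (Y₀ : ℂ) * Complex.I := by
    push_cast; ring
  refine ⟨fun t ht => ?_, fun t ht => ?_⟩
  · -- ascent = reflected descent at `1 − t`
    have ht' : (1 - t) ∈ Icc (0:ℝ) 1 := ⟨by linarith [ht.2], by linarith [ht.1]⟩
    have key := hd (1 - t) ht'
    have e1 : 2 * (x₀ : ℂ) - ((((x₀ + hs / 5 : ℝ) : ℂ) + ((-Y₀ : ℝ) : ℂ) * Complex.I) + ((1 - t : ℝ) : ℂ) *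
        (((x₀ + hs / 2 : ℝ) : ℂ) - (((x₀ + hs / 5 : ℝ) : ℂ) + ((-Y₀ : ℝ) : ℂ) * Complex.I))) =
        ((x₀ - hs / 2 : ℝ) : ℂ) + (t : ℂ) * ((((x₀ - hs / 5 : ℝ) : ℂ) + (Y₀ : ℂ) * Complex.I) - ((x₀ - hs / 2 : ℝ) : ℂ)) := by
      push_cast; ring
    rw [e0, e1] at key
    exact key
  · -- plateau = reflected plateau at `1 − t`
    have ht' : (1 - t) ∈ Icc (0:ℝ) 1 := ⟨by linarith [ht.2], by linarith [ht.1]⟩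
    have key := hp (1 - t) ht'
    have e1 : 2 * (x₀ : ℂ) - (((x₀ : ℂ) + ((-Y₀ : ℝ) : ℂ) * Complex.I) + ((1 - t : ℝ) : ℂ) *
        ((((x₀ : ℂ) + ((-Y₀ : ℝ) : ℂ) * Complex.I) + ((hs / 5 : ℝ) : ℂ)) - ((x₀ : ℂ) + ((-Y₀ : ℝ) : ℂ) * Complex.I))) =
        (((x₀ - hs / 5 : ℝ) : ℂ) + (Y₀ : ℂ) * Complex.I) + (t : ℂ) *
          (((x₀ : ℂ) + (Y₀ : ℂ) * Complex.I) - (((x₀ - hs / 5 : ℝ) : ℂ) + (Y₀ : ℂ) * Complex.I)) := by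
      push_cast; ring
    rw [e0, e1] at key
    exact key

/-- The left wing of an anchor of the quarter stadium lies in the stadium: ascent and plateau sources. [folklore] -/
theorem left_wing_in_stadium {hs L cc x₀ Y₀ : ℝ} (hhs : 0 < hs) (hY : |Y₀| < hs / 4) (hx₀ : |x₀ - cc| < L + hs / 4) :
    (∀ t ∈ Icc (0:ℝ) 1, ((x₀ - hs / 2 : ℝ) : ℂ) + (t : ℂ) *
        ((((x₀ - hs / 5 : ℝ) : ℂ) + (Y₀ : ℂ) * Complex.I) - ((x₀ - hs / 2 : ℝ) : ℂ)) ∈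
        {z : ℂ | |z.im| < hs ∧ |z.re - cc| < L + hs}) ∧
    (∀ t ∈ Icc (0:ℝ) 1, (((x₀ - hs / 5 : ℝ) : ℂ) + (Y₀ : ℂ) * Complex.I) + (t : ℂ) *
        (((x₀ : ℂ) + (Y₀ : ℂ) * Complex.I) - (((x₀ - hs / 5 : ℝ) : ℂ) + (Y₀ : ℂ) * Complex.I)) ∈
        {z : ℂ | |z.im| < hs ∧ |z.re - cc| < L + hs}) := by
  have hY' := abs_lt.mp hY
  have hx' := abs_lt.mp hx₀
  refine ⟨fun t ht => ?_, fun t ht => ?_⟩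
  · have e : ((x₀ - hs / 2 : ℝ) : ℂ) + (t : ℂ) *
        ((((x₀ - hs / 5 : ℝ) : ℂ) + (Y₀ : ℂ) * Complex.I) - ((x₀ - hs / 2 : ℝ) : ℂ)) =
        (((x₀ - hs / 2 + 3 * hs / 10 * t) : ℝ) : ℂ) + ((Y₀ * t : ℝ) : ℂ) * Complex.I := by push_cast; ring
    rw [e]
    constructor
    · simp
      have h1t : |t| ≤ 1 := by rw [abs_le]; constructor <;> linarith [ht.1, ht.2]
      calc |Y₀| * |t| ≤ |Y₀| * 1 := mul_le_mul_of_nonneg_left h1t (abs_nonneg _)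
        _ < hs := by linarith
    · simp; rw [abs_lt]; constructor <;> nlinarith [ht.1, ht.2]
  · have e : (((x₀ - hs / 5 : ℝ) : ℂ) + (Y₀ : ℂ) * Complex.I) + (t : ℂ) *
        (((x₀ : ℂ) + (Y₀ : ℂ) * Complex.I) - (((x₀ - hs / 5 : ℝ) : ℂ) + (Y₀ : ℂ) * Complex.I)) =
        (((x₀ - hs / 5 + t * (hs / 5)) : ℝ) : ℂ) + (Y₀ : ℂ) * Complex.I := by push_cast; ring
    rw [e]
    constructor
    · simp; rw [abs_lt]; constructor <;> linarith
    · simp; rw [abs_lt]; constructor <;> nlinarith [ht.1, ht.2]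

end Summit.NavierStokesRegularity.NavierStokesRegularity.Theorems.StadiumLeftWingPos

end
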